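import Summits.AtomisticToContinuum.Crystallization.Theorems.FrustratedLawDichotomyAperiodicGapRecordJunctionFallbackLever
import Summits.AtomisticToContinuum.Crystallization.Theorems.FrustratedLawDichotomyStrainedPatchPairTubeRecord

/-!
# FrustratedLawDichotomy · crux `AperiodicFrustratedLawGap` (stmt-AtomisticToContinuum-27623) — RIDER: route (F)'s [CORE-FAR] at `26/5` and its RIM from the landed
# PairTube cells (decomp-a2c hand 2, generation 38; structural share, DEF-FREE)

Critic row 1442 (2): «after landing, hand-2's `rim_of_coreOffTubeFloor` + `coreOff_26_5_of_pairTubeRecBy` give route (F)'s RIM hypothesis in one line — as a RIDER file».  The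
ρ-free PairTube junction of lens-5 g84 (`…StrainedPatchPairTubeRecord.coreOff_at_of_pairTubeRecBy`: host-graded E-cell `TubeFloorGBRecBy 𝓘 βf sf` — ρ-BLIND — plus the T-cells
`FamilyCoverGRecAt 𝓘₀ ρ ε` / `RefineGBRecByAt 𝓘₀ 𝓘 ρ ε βf sf` re-instanced at `(ρ, ε)`) delivers [CORE-FAR] at ANY core radius; so on route (F) the WHOLE [CORE-FAR] at `(26/5, 1/100)` —
record piece AND rim — comes from the same E-cell and the `(26/5, 1/100)` T-cells (zero new E-boxes, lens-5 NOTE 08:08:54Z (2) / row 1440 (C)).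

* §1 `rim_26_5_of_pairTubeRecBy` — the RIM `(24/5, 1/100) → (26/5, 1/100)` from the PairTube cells at `26/5` (`rim_of_coreOffTubeFloor ∘ coreOff_26_5_of_pairTubeRecBy`);
  `coreOff_record_of_pairTubeRecBy_at_26_5` — the record [CORE-FAR] at `24/5` from the same cells (`CoreOffTubeFloor.of_le_core`);
* §2 ★★★ `aperiodicFrustratedLawGap_of_entryTreesHTA2QQDCRS3_fallbackLever_pairTube_record` — route (F) at `A = 3/5000` (H floor `1/1250`, level `μ₈₀`) with [CORE-FAR] at `26/5`
  supplied by `TubeFloorGBRecBy ∧ FamilyCoverGRecAt 𝓘₀ (26/5) (1/100) ∧ RefineGBRecByAt 𝓘₀ 𝓘 (26/5) (1/100) βf sf` (`…Reserve.…_fallbackLever_record` at `hC := coreOff_26_5_of_pairTubeRecBy …`),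
  and `…_A1000_record` — the same at `A = 1/1000` (H floor `3/2500`, level `μ₄₀`; `…FallbackLever` §4 via §1).

One-line compositions; 0 sorry; no definitions; no `native_decide`.  `--supports stmt-AtomisticToContinuum-27623`.  [folklore instantiation]
-/

noncomputable section

namespace Summit.AtomisticToContinuum.Crystallization.Theorems.FrustratedLawDichotomyAperiodicGapRecordJunctionFallbackPairTube

open scoped BigOperators RealInnerProductSpace
open Literature.Analysis.ValidatedNumerics.Numerics
open Literature.Barriers.AtomisticToContinuum.FlatleyTheil2015 (fccVec)
open Summit.AtomisticToContinuum.Crystallization.Theorems.ChargedEnergyGapNegative (eStar)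
open Summit.AtomisticToContinuum.Crystallization.Theorems.FrustratedLawDichotomyRangeCut
open Summit.AtomisticToContinuum.Crystallization.Theorems.FrustratedLawDichotomySchurCut
open Summit.AtomisticToContinuum.Crystallization.Theorems.FrustratedLawDichotomyMotifLemmas (GoodAtScale)
open Summit.AtomisticToContinuum.Crystallization.Theorems.FrustratedLawDichotomyAveragingCut
open Summit.AtomisticToContinuum.Crystallization.Theorems.FrustratedLawDichotomyAveragingRuleTightFree (TightNearCap BadNearCap)
open Summit.AtomisticToContinuum.Crystallization.Theorems.FrustratedLawDichotomyExemptAbsorption (ExemptNear)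
open Summit.AtomisticToContinuum.Crystallization.Theorems.FrustratedLawDichotomyExemptLocOpt (LocOptFails)
open Summit.AtomisticToContinuum.Crystallization.Theorems.FrustratedLawDichotomyExemptSplit (SchurElasticPricingX)
open Summit.AtomisticToContinuum.Crystallization.Theorems.FrustratedLawDichotomyExemptAbsorptionRecord
open Summit.AtomisticToContinuum.Crystallization.Theorems.FrustratedLawDichotomyCollarCensus
open Summit.AtomisticToContinuum.Crystallization.Theorems.FrustratedLawDichotomyCollarCensusKappa
open Summit.AtomisticToContinuum.Crystallization.Theorems.FrustratedLawDichotomyStrainedPatchHomSplit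
open Summit.AtomisticToContinuum.Crystallization.Theorems.FrustratedLawDichotomyStrainedPatchCleanCollar
open Summit.AtomisticToContinuum.Crystallization.Theorems.FrustratedLawDichotomyStrainedPatchPhaseCut
open Summit.AtomisticToContinuum.Crystallization.Theorems.FrustratedLawDichotomyStrainedPatchCoreTube
open Summit.AtomisticToContinuum.Crystallization.Theorems.FrustratedLawDichotomyStrainedPatchCoreTubeRecord
open Summit.AtomisticToContinuum.Crystallization.Theorems.FrustratedLawDichotomyStrainedPatchHomCertTree (CertTree treeOK)
open Summit.AtomisticToContinuum.Crystallization.Theorems.FrustratedLawDichotomyStrainedPatchHomEntryGram (rootC rootW)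
open Summit.AtomisticToContinuum.Crystallization.Theorems.FrustratedLawDichotomyStrainedPatchHomEntryGramHcp (rootCH rootWH)
open Summit.AtomisticToContinuum.Crystallization.Theorems.FrustratedLawDichotomyStrainedPatchHomEntryTable (muRec muRec_ok)
open Summit.AtomisticToContinuum.Crystallization.Theorems.FrustratedLawDichotomyStrainedPatchHomEntryTableP (entryLeafOK6RBKP entryLeafOK6RBKP_sound)
open Summit.AtomisticToContinuum.Crystallization.Theorems.FrustratedLawDichotomyStrainedPatchHomEntryLeafHT (entryLeafOKHT4A2QQDCRS3
  entryLeafOKHT4A2QQDCRS3_sound)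
open Summit.AtomisticToContinuum.Crystallization.Theorems.FrustratedLawDichotomyStrainedPatchQuantSlaving (ChartFam)
open Summit.AtomisticToContinuum.Crystallization.Theorems.FrustratedLawDichotomyStrainedPatchPairTube
open Summit.AtomisticToContinuum.Crystallization.Theorems.FrustratedLawDichotomyAperiodicGapRecordJunction
open Summit.AtomisticToContinuum.Crystallization.Theorems.FrustratedLawDichotomyAperiodicGapRecordJunctionTubeTailS3
open Summit.AtomisticToContinuum.Crystallization.Theorems.FrustratedLawDichotomyAperiodicGapRecordJunctionReserve
open Summit.AtomisticToContinuum.Crystallization.Theorems.FrustratedLawDichotomyAperiodicGapRecordJunctionFallbackLever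

/-! ## §1 The rim and the record [CORE-FAR] from the PairTube cells at `26/5` -/

/-- ★ **THE RIM `(24/5, 1/100) → (26/5, 1/100)` FROM THE PAIRTUBE CELLS AT `26/5`**: the ρ-blind host-graded E-cell `TubeFloorGBRecBy 𝓘 βf sf` with the T-cells
`FamilyCoverGRecAt 𝓘₀ (26/5) (1/100)` / `RefineGBRecByAt 𝓘₀ 𝓘 (26/5) (1/100) βf sf` give [CORE-FAR] at `(26/5, 1/100)` (`coreOff_26_5_of_pairTubeRecBy`), hence the rim
(`…FallbackLever.rim_of_coreOffTubeFloor`). [folklore] -/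
theorem rim_26_5_of_pairTubeRecBy {𝓘₀ 𝓘 : ChartFam} {βf sf : (M₀ : ℕ) → (Fin M₀ → E3) → Fin M₀ → ℝ} (hT : TubeFloorGBRecBy 𝓘 βf sf)
    (hK : FamilyCoverGRecAt 𝓘₀ (26 / 5) (1 / 100)) (hD : RefineGBRecByAt 𝓘₀ 𝓘 (26 / 5) (1 / 100) βf sf) :
    RimOffTubeFloor (63 / 10) (63 / 10) (24 / 5) (1 / 100) (26 / 5) (1 / 100) 0 :=
  rim_of_coreOffTubeFloor (by norm_num) (coreOff_26_5_of_pairTubeRecBy hT hK hD)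

/-- … and the record [CORE-FAR] at `24/5` from the same `26/5` cells (`CoreOffTubeFloor.of_le_core`). [formal bookkeeping] -/
theorem coreOff_record_of_pairTubeRecBy_at_26_5 {𝓘₀ 𝓘 : ChartFam} {βf sf : (M₀ : ℕ) → (Fin M₀ → E3) → Fin M₀ → ℝ} (hT : TubeFloorGBRecBy 𝓘 βf sf)
    (hK : FamilyCoverGRecAt 𝓘₀ (26 / 5) (1 / 100)) (hD : RefineGBRecByAt 𝓘₀ 𝓘 (26 / 5) (1 / 100) βf sf) :
    CoreOffTubeFloor (63 / 10) (63 / 10) (24 / 5) (1 / 100) 0 :=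
  (coreOff_26_5_of_pairTubeRecBy hT hK hD).of_le_core (by norm_num)

/-! ## §2 ★★★ Route (F) from the PairTube cells at `26/5` -/

/-- ★★★ **ROUTE (F) AT `A = 3/5000` WITH [CORE-FAR] FROM THE PAIRTUBE CELLS**: trees over `entryLeafOK6RBKP / entryLeafOKHT4A2QQDCRS3 (−399244106966394)` (H floor `1/1250`) ∧ leaf 6′ at
`26/5` with `−1/5000` ∧ `CoreCoreRelief (63/10) (63/10) (26/5) (1/100) (3/5000)` ∧ `TubeFloorGBRecBy 𝓘 βf sf` ∧ `FamilyCoverGRecAt 𝓘₀ (26/5) (1/100)` ∧ `RefineGBRecByAt 𝓘₀ 𝓘 (26/5) (1/100) βf sf`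
∧ the four annulus leaves, CC∪T₀, DD∪T₀, `0 ≤ D_X`, Eopt-raw VERBATIM ⟹ crux. [folklore instantiation: `…Reserve.…_fallbackLever_record` at `hC := coreOff_26_5_of_pairTubeRecBy …`] -/
theorem aperiodicFrustratedLawGap_of_entryTreesHTA2QQDCRS3_fallbackLever_pairTube_record {εE CE DE DX : ℝ} {𝓘₀ 𝓘 : ChartFam}
    {βf sf : (M₀ : ℕ) → (Fin M₀ → E3) → Fin M₀ → ℝ}
    (hε0 : 0 < εE) (hε1 : εE ≤ 1 / 10000) (hDX : 0 ≤ DX)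
    (hE : SchurElasticPricingX (1 / 20) (1 / 8) w₄₅ ω₄ (3 / 400) (-(7175 / 10000)) (1 / 10000) CE DE DX (LocOptFails eStar εE (3 / 2) 1))
    (hFcc : ∃ t : CertTree (Fin 3 × Fin 3), treeOK (entryLeafOK6RBKP (-399244106966394)) t rootC rootW = true)
    (hHcp : ∃ t : CertTree ((Fin 3 × Fin 3) ⊕ Fin 3), treeOK (entryLeafOKHT4A2QQDCRS3 (-399244106966394)) t rootCH rootWH = true)
    (hT : ∀ (M : ℕ) (z : Fin M → E3) (c : Fin M), Admissible M z c → CleanBall (63 / 10) z c → MonoPhaseBall (63 / 10) z c →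
      NearHomIsoAt (26 / 5) (1 / 100) z c → -(1 / 5000) ≤ ballAvg (9 / 5) z (tailOut (26 / 5) M z c) c)
    (hR : CoreCoreRelief (63 / 10) (63 / 10) (26 / 5) (1 / 100) (3 / 5000))
    (hTB : TubeFloorGBRecBy 𝓘 βf sf) (hK : FamilyCoverGRecAt 𝓘₀ (26 / 5) (1 / 100)) (hDf : RefineGBRecByAt 𝓘₀ 𝓘 (26 / 5) (1 / 100) βf sf)
    (hF : AnnularPhaseFloor (63 / 10) (24 / 5) (63 / 10) (1 / 1000)) (hP : PolyTextureFloor (63 / 10) (24 / 5) (1 / 1000))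
    (hA : AnnularDefectFloor (24 / 5) (63 / 10)) (hD : DefectiveCollarFloor (24 / 5))
    (h2 : CrowdedCoreMotifPricingCapK (1 / 1000) (9 / 5) (133 / 10) (3 / 2) (effPot w₄₅ ω₄ (3 / 400)) (-(7175 / 10000) + 3 / 400)
      (Collar (9 / 2) fun N y j => (∃ s : ℝ, 0 ≤ s ∧ s ≤ 3 / 2 ∧ NonEquilibriumCore (-(7175 / 10000)) 0 7 s (1 / 10000) N y j) ∨
        GoodAtScale (1 / 20) (3 / 2) y j))
    (h3 : DiluteDefectMotifPricingCapK (1 / 1000) (9 / 5) (133 / 10) (3 / 2) (effPot w₄₅ ω₄ (3 / 400)) (-(7175 / 10000) + 3 / 400)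
      (Collar (9 / 2) fun N y j => (∃ s : ℝ, 0 ≤ s ∧ s ≤ 3 / 2 ∧ NonEquilibriumCore (-(7175 / 10000)) 0 7 s (1 / 10000) N y j) ∨
        GoodAtScale (1 / 20) (3 / 2) y j)) :
    Summit.AtomisticToContinuum.Crystallization.Theses.FrustratedLawDichotomy.AperiodicFrustratedLawGap :=
  aperiodicFrustratedLawGap_of_entryTreesHTA2QQDCRS3_fallbackLever_record hε0 hε1 hDX hE hFcc hHcp hT hR (coreOff_26_5_of_pairTubeRecBy hTB hK hDf) hF hP
    hA hD h2 h3

/-- ★★ **ROUTE (F) AT `A = 1/1000` WITH [CORE-FAR] FROM THE PAIRTUBE CELLS** (H floor `3/2500`, level `μ₄₀ = −399018926985025`; `…FallbackLever` §4 via the record piece and the rim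
of §1). [folklore instantiation] -/
theorem aperiodicFrustratedLawGap_of_entryTreesHTA2QQDCRS3_fallbackLever_pairTube_A1000_record {εE CE DE DX : ℝ} {𝓘₀ 𝓘 : ChartFam}
    {βf sf : (M₀ : ℕ) → (Fin M₀ → E3) → Fin M₀ → ℝ}
    (hε0 : 0 < εE) (hε1 : εE ≤ 1 / 10000) (hDX : 0 ≤ DX)
    (hE : SchurElasticPricingX (1 / 20) (1 / 8) w₄₅ ω₄ (3 / 400) (-(7175 / 10000)) (1 / 10000) CE DE DX (LocOptFails eStar εE (3 / 2) 1))
    (hFcc : ∃ t : CertTree (Fin 3 × Fin 3), treeOK (entryLeafOK6RBKP (-399018926985025)) t rootC rootW = true)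
    (hHcp : ∃ t : CertTree ((Fin 3 × Fin 3) ⊕ Fin 3), treeOK (entryLeafOKHT4A2QQDCRS3 (-399018926985025)) t rootCH rootWH = true)
    (hT : ∀ (M : ℕ) (z : Fin M → E3) (c : Fin M), Admissible M z c → CleanBall (63 / 10) z c → MonoPhaseBall (63 / 10) z c →
      NearHomIsoAt (26 / 5) (1 / 100) z c → -(1 / 5000) ≤ ballAvg (9 / 5) z (tailOut (26 / 5) M z c) c)
    (hR : CoreCoreRelief (63 / 10) (63 / 10) (26 / 5) (1 / 100) (1 / 1000))
    (hTB : TubeFloorGBRecBy 𝓘 βf sf) (hK : FamilyCoverGRecAt 𝓘₀ (26 / 5) (1 / 100)) (hDf : RefineGBRecByAt 𝓘₀ 𝓘 (26 / 5) (1 / 100) βf sf)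
    (hF : AnnularPhaseFloor (63 / 10) (24 / 5) (63 / 10) (1 / 1000)) (hP : PolyTextureFloor (63 / 10) (24 / 5) (1 / 1000))
    (hA : AnnularDefectFloor (24 / 5) (63 / 10)) (hD : DefectiveCollarFloor (24 / 5))
    (h2 : CrowdedCoreMotifPricingCapK (1 / 1000) (9 / 5) (133 / 10) (3 / 2) (effPot w₄₅ ω₄ (3 / 400)) (-(7175 / 10000) + 3 / 400)
      (Collar (9 / 2) fun N y j => (∃ s : ℝ, 0 ≤ s ∧ s ≤ 3 / 2 ∧ NonEquilibriumCore (-(7175 / 10000)) 0 7 s (1 / 10000) N y j) ∨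
        GoodAtScale (1 / 20) (3 / 2) y j))
    (h3 : DiluteDefectMotifPricingCapK (1 / 1000) (9 / 5) (133 / 10) (3 / 2) (effPot w₄₅ ω₄ (3 / 400)) (-(7175 / 10000) + 3 / 400)
      (Collar (9 / 2) fun N y j => (∃ s : ℝ, 0 ≤ s ∧ s ≤ 3 / 2 ∧ NonEquilibriumCore (-(7175 / 10000)) 0 7 s (1 / 10000) N y j) ∨
        GoodAtScale (1 / 20) (3 / 2) y j)) :
    Summit.AtomisticToContinuum.Crystallization.Theses.FrustratedLawDichotomy.AperiodicFrustratedLawGap :=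
  aperiodicFrustratedLawGap_of_entryTreesHTA2QQDCRS3_fallbackLever_rim_A1000_record hε0 hε1 hDX hE hFcc hHcp hT hR
    (coreOff_record_of_pairTubeRecBy_at_26_5 hTB hK hDf) (rim_26_5_of_pairTubeRecBy hTB hK hDf) hF hP hA hD h2 h3

end Summit.AtomisticToContinuum.Crystallization.Theorems.FrustratedLawDichotomyAperiodicGapRecordJunctionFallbackPairTube

end
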